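import Summits.AtomisticToContinuum.HydrodynamicLimit.Theses.StrongClosureWeakBV
import Literature.MathematicalPhysics.KineticTheory.HardSphereEulerWeak

/-!
# `GeneralStrongClosureT` is the conjunct `HydrodynamicLimit` in costume (redirect strategist r1,
# unit `cstrat-stmt-AtomisticToContinuum-16991-r1`, 2026-08-17)

Route `route-AtomisticToContinuum-StrongClosureWeakBV`, deciding crux
`Summit.AtomisticToContinuum.HydrodynamicLimit.Theses.StrongClosureWeakBV.GeneralStrongClosureT`
(stmt-AtomisticToContinuum-16991, STRONG ENTROPIC CLOSURE BEFORE T*).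

* `C → S` is the route's certified deciding theorem `StrongClosureWeakBV.closes : GeneralStrongClosureT →
  WeakStrongUniquenessHS3D → _root_.HydrodynamicLimit`, whose second binder is the typed instance of the
  Literature fact `Literature.Analysis.PDE.ConservationLaw.dafermos_weak_strong_uniqueness` (Dafermos–DiPerna
  weak–strong uniqueness, Dafermos 2000 Thm 5.2.1) — a KNOWN theorem.
* `S → C` is proved HERE modulo the textbook fact `ClassicalIsWeakEntropic` ("a classical solution of the
  hard-sphere Euler system at small packing is an admissible (= weak entropy) solution in the sense of
  `IsHsEulerWeakEntropySolution`" — integration by parts on `(0,∞) × 𝕋³` plus the entropy EQUALITY of smooth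
  solutions from the Gibbs relation `Z = 1 + η f_ex'`, which is the DEFINITION of `hsCompressibility`, and the
  analyticity of `f_ex` at small packing, `ImplosionDichotomy.HsEosLowDensity`, PROVED as
  `Theorems.hsEosLowDensity_proof`; Dafermos 2005 §4.1 (every classical solution is a weak solution) and
  §4.5/(4.5.4) (smooth solutions satisfy the companion balance law with equality)): take `κ' = id` and the
  classical solution itself — modified off `[0,T)` into a measurable representative — as the entropic limit.

Hence `C ⟺ S` modulo {weak–strong uniqueness, classical-are-admissible}: the "compactness + closure" language
of the crux exposes no structure that a tool could bite which the summit does not already expose, unless its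
pieces (determinism, a priori bounds, flux closure, entropy) are attacked SEPARATELY — see STRATEGY-CENSUS.md,
§Decomposition, for why the two load-bearing pieces have no plan (BoltzmannHypothesisBarrier).
-/

noncomputable section

open MeasureTheory Filter Set
open scoped Topology

namespace Summit.AtomisticToContinuum.HydrodynamicLimit.Cruxes.GeneralStrongClosureT.Costume

open Literature.MathematicalPhysics.KineticTheory Literature.Analysis.FluidPDE
open Summit.AtomisticToContinuum.HydrodynamicLimit.Theses

/-- **CLASSICAL SOLUTIONS ARE ADMISSIBLE** (the textbook half of the costume; Dafermos 2005 §4.1 and (4.5.4)):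
there is a packing threshold `η₁ > 0` (inside the virial analyticity radius of `hsExcessFreeEnergy`) such that
for every reduced diameter `σ > 0`, every horizon `T` and every classical hard-sphere Euler solution `(ρ,u,θ)`
on `[0,T) × 𝕋³` (`IsHardSphereEulerSolution σ T ρ u θ`) whose packing stays `≤ η₁`, there are fields
`(ρ',u',θ')` AGREEING with `(ρ,u,θ)` on `[0,T) × 𝕋³` (a measurable modification off the domain of the
classical solution, where the weak form does not look) that form a weak entropy solution on `[0,T)` in the
sense of `IsHsEulerWeakEntropySolution σ T` (jointly measurable, `L¹`-time-continuous on `[0,T)`, the five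
balance laws in weak form with initial term, and the entropy inequality — with EQUALITY, in fact).
Content: integration by parts in `t ∈ (0,∞)` and on the torus; the entropy balance
`∂ₜ(ρs) + div(ρsu) = 0`, `s = 3/2 log θ − log ρ − f_ex(ρσ³)`, from the Gibbs relation `θ ds = de + p d(1/ρ)`,
`e = 3θ/2`, `p = ρθ(1 + η f_ex'(η))` (`hsPressure`/`hsCompressibility`, definitional) and differentiability of
`f_ex` on `(0, η₁]` (`Theorems.hsEosLowDensity_proof`). Not proved here (planner seat; it is calculus, not the
crux). [cite: Dafermos2005, §4.1 (4.1.6); §4.5 (4.5.4)] -/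
def ClassicalIsWeakEntropic : Prop :=
  ∃ η₁ > (0 : ℝ), ∀ σ : ℝ, 0 < σ → ∀ (T : ℝ) (ρ θ : ℝ → T3 → ℝ) (u : ℝ → T3 → V3),
    IsHardSphereEulerSolution σ T ρ u θ → (∀ t ∈ Set.Ico 0 T, ∀ x, ρ t x * σ ^ 3 ≤ η₁) →
      ∃ (ρ' θ' : ℝ → T3 → ℝ) (u' : ℝ → T3 → V3),
        (∀ t ∈ Set.Ico 0 T, ∀ x, ρ' t x = ρ t x ∧ u' t x = u t x ∧ θ' t x = θ t x) ∧
          IsHsEulerWeakEntropySolution σ T ρ' u' θ'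

/-- **The conjunct implies the crux** (modulo `ClassicalIsWeakEntropic`): `_root_.HydrodynamicLimit →
GeneralStrongClosureT`. With the certified `closes : GeneralStrongClosureT → WeakStrongUniquenessHS3D →
_root_.HydrodynamicLimit` this places the crux: `GeneralStrongClosureT ⟺ HydrodynamicLimit` modulo two
textbook facts (Dafermos weak–strong uniqueness; classical solutions are admissible). Proof: `κ' := id`; the
entropic limit is the classical solution itself (its measurable modification `(ρ',u',θ')`); conclusion (i) is
`ClassicalIsWeakEntropic` restricted to `[0,T')` (`IsHsEulerWeakEntropySolution.mono`) plus box bounds by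
compactness of `[0,T'] × 𝕋³` (as in `closes`), packing `ρσ³ ≤ η ≤ 2η`; (ii) holds everywhere (`0 < T`);
(iii) is the conjunct's law of large numbers at `t`, composed with `κ`, the joint deviation event being
contained in the union of the three componentwise events. -/
theorem generalStrongClosureT_of_hydrodynamicLimit (hcl : ClassicalIsWeakEntropic)
    (hS : _root_.HydrodynamicLimit) : StrongClosureWeakBV.GeneralStrongClosureT := by
  obtain ⟨η₁, hη₁, Hcl⟩ := hcl
  obtain ⟨η₂, hη₂, HS⟩ := hS
  refine ⟨min η₁ (η₂ / 2), lt_min hη₁ (half_pos hη₂), ?_⟩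
  intro η hη hηle a₀ θ₀ u₀ ha hθ hu hpos
  have hηη₁ : η ≤ η₁ := hηle.trans (min_le_left _ _)
  have hηη₂ : η < η₂ := by
    have h := hηle.trans (min_le_right η₁ (η₂ / 2))
    linarith
  obtain ⟨σ₀, hσ₀, HSσ⟩ := HS a₀ θ₀ u₀ ha hθ hu (fun x => (hpos x).1) (fun x => (hpos x).2)
  refine ⟨σ₀, hσ₀, ?_⟩
  intro σ hσ hσσ₀
  dsimp only
  intro T ρ θ u hsol hT hguard Φ hLLN0 κ hκ
  -- the classical solution (measurably modified off `[0,T)`) as its own entropic limit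
  obtain ⟨ρ', θ', u', heq, hweak⟩ :=
    Hcl σ hσ T ρ θ u hsol (fun t ht x => (hguard t ht x).trans hηη₁)
  have hguardS : ∀ t ∈ Set.Ico (0 : ℝ) T, ∀ x, ρ t x * σ ^ 3 < η₂ :=
    fun t ht x => (hguard t ht x).trans_lt hηη₂
  have HSt := HSσ σ hσ hσσ₀ T ρ θ u hsol hguardS Φ hLLN0
  refine ⟨id, strictMono_id, ρ', θ', u', fun T' hT'T => ⟨?_, ?_⟩, ?_, ?_⟩
  · -- (i-a) weak entropy solution on `[0,T')`: the named Literature notion, restricted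
    have hw : IsHsEulerWeakEntropySolution σ T' ρ' u' θ' := hweak.mono hT'T.le
    exact ⟨hw.measurable.1, hw.measurable.2, hw.timeContinuousL1, fun φ hφ hsupp =>
      ⟨hw.mass φ ⟨hφ, hsupp⟩, hw.momentum φ ⟨hφ, hsupp⟩, hw.energy φ ⟨hφ, hsupp⟩,
        hw.entropy φ ⟨hφ, hsupp⟩⟩⟩
  · -- (i-b) a box on `[0,T')` with packing `≤ 2η`, from compactness of `[0,T'] × 𝕋³`
    by_cases hT'0 : 0 ≤ T'
    · have hsub : Set.Ico (0 : ℝ) T' ⊆ Set.Ico 0 T := Set.Ico_subset_Ico_right hT'T.le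
      have hIccsub : Set.Icc (0 : ℝ) T' ⊆ Set.Ico 0 T := fun s hs => ⟨hs.1, hs.2.trans_lt hT'T⟩
      obtain ⟨Kc, hKc, hrepr⟩ : ∃ Kc : Set (EuclideanSpace ℝ (Fin 3)), IsCompact Kc ∧
          ∀ x : UnitAddTorus (Fin 3), Literature.Analysis.FunctionSpaces.Torus.repr x ∈ Kc :=
        ⟨(WithLp.toLp 2) '' (Set.pi Set.univ fun _ : Fin 3 => Set.Icc (0 : ℝ) 1),
          (isCompact_univ_pi fun _ => isCompact_Icc).image (PiLp.continuous_toLp 2 _),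
          fun x => ⟨fun i => ((AddCircle.equivIco (1 : ℝ) (0 : ℝ) (x i) : ℝ)),
            fun i _ => Set.Ico_subset_Icc_self
              (Literature.Analysis.FunctionSpaces.Torus.repr_apply_mem_Ico x i), rfl⟩⟩
      have hK : IsCompact (Set.Icc (0 : ℝ) T' ×ˢ Kc) := isCompact_Icc.prod hKc
      have hKsub : Set.Icc (0 : ℝ) T' ×ˢ Kc ⊆
          Set.Ico (0 : ℝ) T ×ˢ (Set.univ : Set (EuclideanSpace ℝ (Fin 3))) :=
        Set.prod_mono hIccsub (Set.subset_univ _)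
      have hKne : (Set.Icc (0 : ℝ) T' ×ˢ Kc).Nonempty :=
        ⟨(0, Literature.Analysis.FunctionSpaces.Torus.repr 0),
          Set.mk_mem_prod ⟨le_rfl, hT'0⟩ (hrepr 0)⟩
      have hbound : ∀ {F : Type} [NormedAddCommGroup F] [NormedSpace ℝ F]
          (f : ℝ → UnitAddTorus (Fin 3) → F),
          Literature.Analysis.FunctionSpaces.Torus.IsSmoothSpaceTimeOn (Set.Ico 0 T) f →
          ∃ C : ℝ, ∀ s ∈ Set.Ico (0 : ℝ) T', ∀ x, ‖f s x‖ ≤ C := by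
        intro F _ _ f hf
        obtain ⟨C, hC⟩ := hK.exists_bound_of_continuousOn
          ((ContDiffOn.continuousOn hf).mono hKsub)
        refine ⟨C, fun s hs x => ?_⟩
        have h := hC (s, Literature.Analysis.FunctionSpaces.Torus.repr x)
          (Set.mk_mem_prod (Set.Ico_subset_Icc_self hs) (hrepr x))
        simpa [Literature.Analysis.FunctionSpaces.Torus.stLift,
          Literature.Analysis.FunctionSpaces.Torus.proj_repr] using h
      have hlower : ∀ (f : ℝ → UnitAddTorus (Fin 3) → ℝ),
          Literature.Analysis.FunctionSpaces.Torus.IsSmoothSpaceTimeOn (Set.Ico 0 T) f →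
          (∀ s ∈ Set.Ico (0 : ℝ) T, ∀ x, 0 < f s x) →
          ∃ c : ℝ, 0 < c ∧ ∀ s ∈ Set.Ico (0 : ℝ) T', ∀ x, c ≤ f s x := by
        intro f hf hposf
        obtain ⟨p, hpK, hmin⟩ := hK.exists_isMinOn hKne ((ContDiffOn.continuousOn hf).mono hKsub)
        refine ⟨Literature.Analysis.FunctionSpaces.Torus.stLift f p,
          hposf p.1 (hIccsub (Set.mem_prod.1 hpK).1) _, fun s hs x => ?_⟩
        have h := (isMinOn_iff.1 hmin) (s, Literature.Analysis.FunctionSpaces.Torus.repr x)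
          (Set.mk_mem_prod (Set.Ico_subset_Icc_self hs) (hrepr x))
        simpa [Literature.Analysis.FunctionSpaces.Torus.stLift,
          Literature.Analysis.FunctionSpaces.Torus.proj_repr] using h
      obtain ⟨Cρ, hCρ⟩ := hbound ρ hsol.smooth_density
      obtain ⟨Cθ, hCθ⟩ := hbound θ hsol.smooth_temperature
      obtain ⟨Cu, hCu⟩ := hbound u hsol.smooth_velocity
      obtain ⟨cρ, hcρ, hcρ'⟩ := hlower ρ hsol.smooth_density hsol.density_pos
      obtain ⟨cθ, hcθ, hcθ'⟩ := hlower θ hsol.smooth_temperature hsol.temperature_pos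
      refine ⟨min cρ cθ, max Cρ (max Cθ Cu), lt_min hcρ hcθ, fun s hs x => ?_⟩
      obtain ⟨e₁, e₂, e₃⟩ := heq s (hsub hs) x
      rw [e₁, e₂, e₃]
      refine ⟨(min_le_left _ _).trans (hcρ' s hs x),
        (Real.le_norm_self _).trans ((hCρ s hs x).trans (le_max_left _ _)),
        (min_le_right _ _).trans (hcθ' s hs x),
        (Real.le_norm_self _).trans ((hCθ s hs x).trans
          ((le_max_left _ _).trans (le_max_right _ _))),
        (hCu s hs x).trans ((le_max_right _ _).trans (le_max_right _ _)), ?_⟩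
      have h2 : ρ s x * σ ^ 3 ≤ η := hguard s (hsub hs) x
      linarith
    · refine ⟨1, 1, one_pos, fun s hs x => ?_⟩
      exact absurd (hs.1.trans_lt hs.2) (fun h => hT'0 h.le)
  · -- (ii) the `t = 0` slice is the classical datum (everywhere; `0 ∈ [0,T)` as `0 < T`)
    exact Filter.Eventually.of_forall fun x => heq 0 ⟨le_rfl, hT⟩ x
  · -- (iii) the law of large numbers along `κ ∘ id` at every `t < T`, from the conjunct
    intro t ht χ hχ δ hδ
    obtain ⟨hρN, hmN, hEN⟩ := HSt t ht χ hχ δ hδ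
    have e₁ : ∫ x, χ x * ρ' t x = ∫ x, χ x * ρ t x :=
      MeasureTheory.integral_congr_ae (Filter.Eventually.of_forall fun x => by
        simp only [(heq t ht x).1])
    have e₂ : ∫ x, (χ x * ρ' t x) • u' t x = ∫ x, (χ x * ρ t x) • u t x :=
      MeasureTheory.integral_congr_ae (Filter.Eventually.of_forall fun x => by
        simp only [(heq t ht x).1, (heq t ht x).2.1])
    have e₃ : ∫ x, χ x * totalEnergyDensity (ρ' t x) (u' t x) (θ' t x) =
        ∫ x, χ x * totalEnergyDensity (ρ t x) (u t x) (θ t x) :=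
      MeasureTheory.integral_congr_ae (Filter.Eventually.of_forall fun x => by
        simp only [(heq t ht x).1, (heq t ht x).2.1, (heq t ht x).2.2])
    simp_rw [e₁, e₂, e₃]
    have hκt : Filter.Tendsto κ Filter.atTop Filter.atTop := hκ.tendsto_atTop
    have hsum := ((hρN.comp hκt).add (hmN.comp hκt)).add (hEN.comp hκt)
    rw [add_zero, add_zero] at hsum
    refine tendsto_of_tendsto_of_tendsto_of_le_of_le tendsto_const_nhds hsum
      (fun n => zero_le) fun n => ?_
    simp only [Function.comp_apply]
    refine (MeasureTheory.measure_mono ?_).trans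
      ((MeasureTheory.measure_union_le _ _).trans
        (add_le_add (MeasureTheory.measure_union_le _ _) le_rfl))
    intro z hz
    have hz' : δ < dist _ _ := hz
    simp only [Prod.dist_eq] at hz'
    simp only [Set.mem_union]
    change (δ < |_| ∨ δ < ‖_‖) ∨ δ < |_|
    rcases lt_max_iff.1 hz' with h | h
    · exact Or.inl (Or.inl (by simpa [Real.dist_eq] using h))
    · rcases lt_max_iff.1 h with h' | h'
      · exact Or.inl (Or.inr (by simpa [dist_eq_norm] using h'))
      · exact Or.inr (by simpa [Real.dist_eq] using h')

/-- **The placing, packaged**: modulo the two textbook facts the crux and the conjunct are EQUIVALENT —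
`(C → S)` from the certified `closes` and Dafermos weak–strong uniqueness (`WeakStrongUniquenessHS3D`),
`(S → C)` from `generalStrongClosureT_of_hydrodynamicLimit` and `ClassicalIsWeakEntropic`. -/
theorem generalStrongClosureT_iff_hydrodynamicLimit (hcl : ClassicalIsWeakEntropic)
    (hwsu : StrongClosureWeakBV.WeakStrongUniquenessHS3D) :
    StrongClosureWeakBV.GeneralStrongClosureT ↔ _root_.HydrodynamicLimit :=
  ⟨fun h => StrongClosureWeakBV.closes h hwsu, generalStrongClosureT_of_hydrodynamicLimit hcl⟩

end Summit.AtomisticToContinuum.HydrodynamicLimit.Cruxes.GeneralStrongClosureT.Costume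

end
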